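import Mathlib.Algebra.Order.Field.Basic
import Mathlib.Data.Finset.Max
import Mathlib.Tactic.FieldSimp
import Mathlib.Tactic.Ring
import Mathlib.Tactic.Linarith
import Mathlib.Tactic.Positivity
import HarnessLib

/-!
# Stochastic rounding: definition, unbiasedness, variance (Connolly–Higham–Mary 2021)

Verbatim formalisation of the *one-rounding* layer of

* M. P. Connolly, N. J. Higham, T. Mary, *Stochastic rounding and its probabilistic backward
  error analysis*, SIAM J. Sci. Comput. 43(1) (2021) A566–A585 [cite: ConnollyHighamMary2021] —
  the rounding candidates `⌊x⌋ = max {y ∈ F : y ≤ x}`, `⌈x⌉ = min {y ∈ F : y ≥ x}` (§1), the two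
  stochastic rounding modes (1.1) (up/down with probability `1/2`) and (1.2) (up with probability
  `p = (x - ⌊x⌋)/(⌈x⌉ - ⌊x⌋)`, "mode 2", also called SR-nearness), and Lemma 4.4: under mode 2,
  `E(fl(x)) = x` (the rounding error has mean zero), together with the remark after Lemma 4.4 that
  mode 1 has mean `(⌊x⌋ + ⌈x⌉)/2 ≠ x` in general;
* E.-M. El Arar, D. Sohier, P. de Oliveira Castro, E. Petit, *Stochastic rounding variance and
  probabilistic bounds: a new approach*, SIAM J. Sci. Comput. 45(5) (2023) C255–C275
  [cite: ArarEtAl2023] — the variance identity of §3,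
  `V(fl(x)) = ε(x)² θ(x)(1 − θ(x)) = (x − ⌊x⌋)(⌈x⌉ − x)`, and its consequence
  `V(fl(x)) ≤ ε(x)²/4` where `ε(x) = ⌈x⌉ − ⌊x⌋`.

## Design

The number system `F` is an arbitrary nonempty *finite* set of elements of a linearly ordered
field `K` (the papers take `K = ℝ` and `F` a floating-point system (2.1) with bounded exponent
range, hence finite; we keep `K` general so that the same declarations serve exact rational
computation, `K = ℚ`). A single stochastic rounding of `x` is a two-point law on
`{⌊x⌋, ⌈x⌉}`; since only its mean and variance are used at this layer we record the law by the
probability `probUp F x` of the upper candidate and define the mean `srMean` and variance `srVar`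
as the corresponding two-term sums — no measure theory is needed, and every identity below is an
exact identity in `K`. The probabilistic *multi-rounding* results of the paper (mean independence,
Lemma 4.5; the martingale bound, Theorem 4.8; inner products, Theorems 4.9 and 4.13) are typed in
the companion file `ProbabilisticBounds.lean` of this directory.

Junk values (documented, never used silently): if no element of `F` lies below `x` then
`roundDown F x = x`, and dually for `roundUp`; consequently for `x` outside the *hull*
`[min F, max F]` the "law" degenerates and the theorems below hold trivially. Every statement
that needs the candidates to be members of `F` carries the hypothesis explicitly.

## Not here

Floating-point *formats* (precision, exponent range, subnormals, saturation), the relative-error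
model `fl(x) = x(1+δ)`, `|δ| ≤ 2u` ((2.4b) of the paper) and everything about sequences of
roundings: those live in `ProbabilisticBounds.lean` and, for the low-precision formats, in the
CertifiedArithmetic venture files which import this one.
-/

namespace Literature.ComputerArithmetic.ConnollyHighamMary2021

section Candidates

variable {K : Type*} [LinearOrder K]

/-! ### Rounding candidates -/

/-- `⌊x⌋ = max {y ∈ F : y ≤ x}`, the lower rounding candidate of `x` in the number system `F`
(junk value `x` itself when no element of `F` is `≤ x`).
[cite: ConnollyHighamMary2021, §1 (definition before (1.1))] -/
def roundDown (F : Finset K) (x : K) : K :=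
  if h : (F.filter (· ≤ x)).Nonempty then (F.filter (· ≤ x)).max' h else x

/-- `⌈x⌉ = min {y ∈ F : y ≥ x}`, the upper rounding candidate of `x` in `F`
(junk value `x` itself when no element of `F` is `≥ x`).
[cite: ConnollyHighamMary2021, §1 (definition before (1.1))] -/
def roundUp (F : Finset K) (x : K) : K :=
  if h : (F.filter (x ≤ ·)).Nonempty then (F.filter (x ≤ ·)).min' h else x

/-- `⌊x⌋ ≤ x` (unconditionally, by the choice of junk value). [cite: ConnollyHighamMary2021, §1] -/
theorem roundDown_le (F : Finset K) (x : K) : roundDown F x ≤ x := by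
  unfold roundDown
  split_ifs with h
  · exact (Finset.mem_filter.mp (Finset.max'_mem _ h)).2
  · exact le_rfl

/-- `x ≤ ⌈x⌉` (unconditionally). [cite: ConnollyHighamMary2021, §1] -/
theorem le_roundUp (F : Finset K) (x : K) : x ≤ roundUp F x := by
  unfold roundUp
  split_ifs with h
  · exact (Finset.mem_filter.mp (Finset.min'_mem _ h)).2
  · exact le_rfl

/-- `⌊x⌋ ≤ ⌈x⌉`. [cite: ConnollyHighamMary2021, §1] -/
theorem roundDown_le_roundUp (F : Finset K) (x : K) : roundDown F x ≤ roundUp F x :=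
  (roundDown_le F x).trans (le_roundUp F x)

/-- If some element of `F` is `≤ x` then `⌊x⌋ ∈ F`. [cite: ConnollyHighamMary2021, §1] -/
theorem roundDown_mem {F : Finset K} {x : K} (h : ∃ y ∈ F, y ≤ x) : roundDown F x ∈ F := by
  obtain ⟨y, hy, hyx⟩ := h
  have hne : (F.filter (· ≤ x)).Nonempty := ⟨y, Finset.mem_filter.mpr ⟨hy, hyx⟩⟩
  unfold roundDown
  rw [dif_pos hne]
  exact (Finset.mem_filter.mp (Finset.max'_mem _ hne)).1

/-- If some element of `F` is `≥ x` then `⌈x⌉ ∈ F`. [cite: ConnollyHighamMary2021, §1] -/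
theorem roundUp_mem {F : Finset K} {x : K} (h : ∃ y ∈ F, x ≤ y) : roundUp F x ∈ F := by
  obtain ⟨y, hy, hxy⟩ := h
  have hne : (F.filter (x ≤ ·)).Nonempty := ⟨y, Finset.mem_filter.mpr ⟨hy, hxy⟩⟩
  unfold roundUp
  rw [dif_pos hne]
  exact (Finset.mem_filter.mp (Finset.min'_mem _ hne)).1

/-- `⌊x⌋` is the *largest* element of `F` below `x`. [cite: ConnollyHighamMary2021, §1] -/
theorem le_roundDown_of_mem {F : Finset K} {x y : K} (hy : y ∈ F) (hyx : y ≤ x) :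
    y ≤ roundDown F x := by
  have hne : (F.filter (· ≤ x)).Nonempty := ⟨y, Finset.mem_filter.mpr ⟨hy, hyx⟩⟩
  unfold roundDown
  rw [dif_pos hne]
  exact Finset.le_max' _ _ (Finset.mem_filter.mpr ⟨hy, hyx⟩)

/-- `⌈x⌉` is the *smallest* element of `F` above `x`. [cite: ConnollyHighamMary2021, §1] -/
theorem roundUp_le_of_mem {F : Finset K} {x y : K} (hy : y ∈ F) (hxy : x ≤ y) :
    roundUp F x ≤ y := by
  have hne : (F.filter (x ≤ ·)).Nonempty := ⟨y, Finset.mem_filter.mpr ⟨hy, hxy⟩⟩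
  unfold roundUp
  rw [dif_pos hne]
  exact Finset.min'_le _ _ (Finset.mem_filter.mpr ⟨hy, hxy⟩)

/-- Rounding a member of `F` leaves it unchanged: `⌊x⌋ = x` for `x ∈ F`
("fl(fl(x)) = fl(x)", §3.1). [cite: ConnollyHighamMary2021, §3.1] -/
theorem roundDown_eq_self_of_mem {F : Finset K} {x : K} (hx : x ∈ F) : roundDown F x = x :=
  le_antisymm (roundDown_le F x) (le_roundDown_of_mem hx le_rfl)

/-- `⌈x⌉ = x` for `x ∈ F`. [cite: ConnollyHighamMary2021, §3.1] -/
theorem roundUp_eq_self_of_mem {F : Finset K} {x : K} (hx : x ∈ F) : roundUp F x = x :=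
  le_antisymm (roundUp_le_of_mem hx le_rfl) (le_roundUp F x)

/-- No element of `F` lies strictly between `⌊x⌋` and `⌈x⌉`: the candidates are adjacent
("for `x ∉ F`, `⌊x⌋` and `⌈x⌉` are adjacent floating-point numbers", §1).
[cite: ConnollyHighamMary2021, §1] -/
theorem not_mem_of_between {F : Finset K} {x y : K} (h₁ : roundDown F x < y)
    (h₂ : y < roundUp F x) : y ∉ F := by
  intro hy
  rcases le_total y x with hyx | hxy
  · exact absurd (le_roundDown_of_mem hy hyx) (not_le.mpr h₁)
  · exact absurd (roundUp_le_of_mem hy hxy) (not_le.mpr h₂)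

/-- If `⌈x⌉ = ⌊x⌋` then both equal `x`. [folklore] -/
theorem eq_of_roundUp_eq_roundDown {F : Finset K} {x : K} (h : roundUp F x = roundDown F x) :
    roundDown F x = x :=
  le_antisymm (roundDown_le F x) (h ▸ le_roundUp F x)

end Candidates

section StochasticRounding

variable {K : Type*} [Field K] [LinearOrder K] [IsStrictOrderedRing K]

/-! ### The two stochastic rounding modes -/

/-- The probability `p = (x − ⌊x⌋)/(⌈x⌉ − ⌊x⌋)` of rounding *up* in mode 2 stochastic rounding
(1.2) ("SR-nearness"); by the field convention `a / 0 = 0` it is `0` when `⌈x⌉ = ⌊x⌋`, i.e. when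
`x ∈ F`, where no rounding happens. [cite: ConnollyHighamMary2021, (1.2)] -/
def probUp (F : Finset K) (x : K) : K :=
  (x - roundDown F x) / (roundUp F x - roundDown F x)

/-- `0 ≤ p`. [cite: ConnollyHighamMary2021, (1.2)] -/
theorem probUp_nonneg (F : Finset K) (x : K) : 0 ≤ probUp F x :=
  div_nonneg (sub_nonneg.mpr (roundDown_le F x)) (sub_nonneg.mpr (roundDown_le_roundUp F x))

/-- `p ≤ 1`. [cite: ConnollyHighamMary2021, (1.2)] -/
theorem probUp_le_one (F : Finset K) (x : K) : probUp F x ≤ 1 :=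
  div_le_one_of_le₀ (sub_le_sub_right (le_roundUp F x) _)
    (sub_nonneg.mpr (roundDown_le_roundUp F x))

/-- Mean of mode 2 stochastic rounding (1.2): `E(fl(x)) = p ⌈x⌉ + (1 − p) ⌊x⌋`.
[cite: ConnollyHighamMary2021, (1.2) and proof of Lemma 4.4] -/
def srMean (F : Finset K) (x : K) : K :=
  probUp F x * roundUp F x + (1 - probUp F x) * roundDown F x

/-- Mean of mode 1 stochastic rounding (1.1) (up or down with probability `1/2` each):
`E(fl(x)) = (⌊x⌋ + ⌈x⌉)/2`. [cite: ConnollyHighamMary2021, (1.1) and remark after Lemma 4.4] -/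
def srMode1Mean (F : Finset K) (x : K) : K :=
  (roundDown F x + roundUp F x) / 2

omit [IsStrictOrderedRing K] in
/-- **Lemma 4.4 (mode 2 stochastic rounding is unbiased).** `E(fl(x)) = x`; equivalently the
relative error `δ = (fl(x) − x)/x` has `E(δ) = 0`. Holds for every `x` (for `x` outside the hull
of `F` only through the junk convention `⌊x⌋ = x` or `⌈x⌉ = x`; see `srMean_eq_self`'s use in the
venture files, where membership of the candidates in `F` is tracked separately).
[cite: ConnollyHighamMary2021, Lemma 4.4] -/
theorem srMean_eq_self (F : Finset K) (x : K) : srMean F x = x := by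
  unfold srMean probUp
  by_cases h : roundUp F x = roundDown F x
  · have hd : roundDown F x = x := eq_of_roundUp_eq_roundDown h
    rw [h, hd, sub_self, div_zero]
    ring
  · have hne : roundUp F x - roundDown F x ≠ 0 := sub_ne_zero.mpr h
    field_simp
    ring

/-- Mode 1 is *not* unbiased: its mean is the midpoint of the candidates, which differs from `x`
unless `x` is that midpoint (remark after Lemma 4.4: "(1.1) implies `E(fl(x)) = (⌊x⌋ + ⌈x⌉)/2`,
which is in general not equal to `x`"). Recorded as the exact criterion.
[cite: ConnollyHighamMary2021, remark after Lemma 4.4] -/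
theorem srMode1Mean_eq_self_iff (F : Finset K) (x : K) :
    srMode1Mean F x = x ↔ roundDown F x + roundUp F x = 2 * x := by
  unfold srMode1Mean
  constructor
  · intro h; linarith [h]
  · intro h; linarith [h]

/-! ### Variance of one stochastic rounding (El Arar–Sohier–de Oliveira Castro–Petit 2023, §3) -/

/-- Variance of mode 2 stochastic rounding as the two-term sum
`V(fl(x)) = p (⌈x⌉ − x)² + (1 − p)(⌊x⌋ − x)²` (second central moment of the two-point law; the
mean is `x` by Lemma 4.4). [cite: ArarEtAl2023, §3 (display before Lemma 3.1)] -/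
def srVar (F : Finset K) (x : K) : K :=
  probUp F x * (roundUp F x - x) ^ 2 + (1 - probUp F x) * (roundDown F x - x) ^ 2

omit [IsStrictOrderedRing K] in
/-- **Variance identity** `V(fl(x)) = ε(x)² θ(x)(1 − θ(x)) = (x − ⌊x⌋)(⌈x⌉ − x)` where
`ε(x) = ⌈x⌉ − ⌊x⌋` and `θ(x) = p`. [cite: ArarEtAl2023, §3 (display before Lemma 3.1)] -/
theorem srVar_eq (F : Finset K) (x : K) :
    srVar F x = (x - roundDown F x) * (roundUp F x - x) := by
  unfold srVar probUp
  by_cases h : roundUp F x = roundDown F x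
  · have hd : roundDown F x = x := eq_of_roundUp_eq_roundDown h
    rw [h, hd, sub_self, div_zero]
    ring
  · have hne : roundUp F x - roundDown F x ≠ 0 := sub_ne_zero.mpr h
    field_simp
    ring

omit [IsStrictOrderedRing K] in
/-- The same identity in the paper's form `V = ε² θ (1 − θ)`.
[cite: ArarEtAl2023, §3 (display before Lemma 3.1)] -/
theorem srVar_eq_gap_sq_mul (F : Finset K) (x : K) :
    srVar F x = (roundUp F x - roundDown F x) ^ 2 * (probUp F x * (1 - probUp F x)) := by
  rw [srVar_eq]
  unfold probUp
  by_cases h : roundUp F x = roundDown F x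
  · have hd : roundDown F x = x := eq_of_roundUp_eq_roundDown h
    rw [h, hd, sub_self]
    ring
  · have hne : roundUp F x - roundDown F x ≠ 0 := sub_ne_zero.mpr h
    field_simp
    ring

/-- `0 ≤ V(fl(x))`. [folklore] -/
theorem srVar_nonneg (F : Finset K) (x : K) : 0 ≤ srVar F x := by
  rw [srVar_eq]
  exact mul_nonneg (sub_nonneg.mpr (roundDown_le F x)) (sub_nonneg.mpr (le_roundUp F x))

/-- **Variance bound** `V(fl(x)) ≤ ε(x)²/4` (maximised when `x` is the midpoint of its
candidates); with `ε(x) ≤ |x| u` (normal range, `u = β^{1-p}`) this is the paper's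
`V(fl(x)) ≤ x² u²/4`. [cite: ArarEtAl2023, §3 ("Using (2.3) leads to V ≤ x²u²/4")] -/
theorem srVar_le_gap_sq_div_four (F : Finset K) (x : K) :
    srVar F x ≤ (roundUp F x - roundDown F x) ^ 2 / 4 := by
  rw [srVar_eq]
  nlinarith [sq_nonneg ((x - roundDown F x) - (roundUp F x - x))]

omit [IsStrictOrderedRing K] in
/-- A member of `F` is rounded exactly: zero variance. [folklore] -/
theorem srVar_eq_zero_of_mem {F : Finset K} {x : K} (hx : x ∈ F) : srVar F x = 0 := by
  rw [srVar_eq, roundDown_eq_self_of_mem hx, sub_self, zero_mul]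

/-! ### Sure error bounds for either outcome -/

/-- Either outcome of stochastic rounding is within `ε(x) = ⌈x⌉ − ⌊x⌋` of `x`: the upper one.
(With `ε(x) ≤ 2u|x|` in the normal range this is the model `fl(x) = x(1+δ)`, `|δ| ≤ 2u`, (2.4b).)
[cite: ConnollyHighamMary2021, (2.4b)] -/
theorem abs_roundUp_sub_le (F : Finset K) (x : K) :
    |roundUp F x - x| ≤ roundUp F x - roundDown F x := by
  rw [abs_of_nonneg (sub_nonneg.mpr (le_roundUp F x))]
  exact sub_le_sub_left (roundDown_le F x) _

/-- Either outcome of stochastic rounding is within `ε(x)` of `x`: the lower one.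
[cite: ConnollyHighamMary2021, (2.4b)] -/
theorem abs_roundDown_sub_le (F : Finset K) (x : K) :
    |roundDown F x - x| ≤ roundUp F x - roundDown F x := by
  rw [abs_sub_comm, abs_of_nonneg (sub_nonneg.mpr (roundDown_le F x))]
  exact sub_le_sub_right (le_roundUp F x) _

end StochasticRounding

end Literature.ComputerArithmetic.ConnollyHighamMary2021
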